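import Summits.Ventures.HodgeRepro.Night4Closers

/-!
# Closer C2 of ROUTE.md §4 — Markman 2025b Theorem 1.1.2 as a PRINTED hypothesis, and the open input it leaves

Blind re-derivation cell `pub-hodge-repro`, seat `night-4` (ROUTE HARDENING for the Monday FINAL, gen 4).  Target tree
path `lean/Summits/Ventures/HodgeRepro/Night4SecantPair.lean`.

ROUTE.md v2.89 §4 («Closers of S4 — the object or computation that would close each, ranked») item 4: «(C2) A
semiregular B-secant sheaf pair (F₁, F₂) on an abelian variety X with real multiplication by F⁺ (Markman 2025b,
Thm 1.1.2, paper:arxiv-2509.23079 p0004).  If the flat deformation of κ(Φ(F₁ ⊠ F₂^∨)) remains algebraic on every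
Weil-type deformation of (X × X̂, η) then every Weil class there is algebraic; semiregularity (Buchweitz–Flenner) makes
the deformation algebraic (genus-3 Jacobian, F⁺ = ℚ).  For [F:ℚ] > 2 the search is "postpone[d] for future work"
(p0005:L1–6) … Closes S4 for the whole deformation class of B (Landherr, D1 4.1–4.2) once ONE such pair exists with
ch(F₁) ⊗ ch(F₂) generic.»  Items 1, 3 and 5 of §4 and the S4′ / invariant-cycles / frontier chains are named in
`Night4Closers` (five open inputs, `S0_of_any_closer₅`); item 2 (C7) is the night-2 lane's; item 4 had no named
statement in the tree.  This file types it: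

* `SecantData` — the objects of Markman's construction on the `RouteData` interface: the abelian varieties `X` with real
  multiplication by the totally real subfield, the `B`-secant sheaf pairs `(F₁, F₂)` on `X`, the genericity criterion
  of Proposition 1.1.1, the relation «`(A′, η′)` is of Weil type and deformation equivalent to `(X × X̂, η)`», and the flat
  deformation of the class `κ(Φ(F₁ ⊠ F₂^∨))` to `(A′, η′)` as its graded pieces in `H^{2k}(A′, ℚ)(k)`.  NOTHING is
  constructed; the fields assert nothing.
* `Markman2025b_Thm1_1_2` — the theorem AS PRINTED (quote and store page:line in the docstring), in the route's
  vocabulary: Markman's `K` is the route's CM field `F`, his totally real `F` is the route's `F⁺`, his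
  `HW(A′, η′) = ∧^d_K H¹(A′, ℚ)` with `d = dim_K H¹(A′, ℚ)` is the route's Weil line `W_F(A′) = ∧^{2p}_F H¹(A′, ℚ)`,
  `p = d/2`.
* `OpenSecantPair` — the OPEN input exactly as §4 item 4 states it (one generic pair per S4 instance whose flat
  deformation is algebraic), `OpenSecantPairClass` — its «whole deformation class» form; `S4_of_secantPair`,
  `S0_of_openSecantPair`: the closer composed with the chain of `RouteChain`.
* `SemiregularData`, `SemiregularDeforms`, `OpenSemiregularPair` — the semiregularity form of the same input: the
  route's clause «semiregularity (Buchweitz–Flenner) makes the deformation algebraic» is NAMED as a hypothesis (it is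
  printed only for `F⁺ = ℚ` and the Jacobian of a genus-3 curve, Markman p0005:L1–3), never asserted.
* `SecantClosersData`, `PrintedInputs₆`, `OpenSecant`, `S0_of_any_closer₆` — the SIX named open inputs of ROUTE.md
  §1 / §4 in one statement, extending `Night4Closers.S0_of_any_closer₅`.

HONESTY.  Theorem 1.1.2 is typed as a hypothesis (a `def … : Prop`), not proved; its printed proof rests on the whole
paper.  No open input is closed; `S4` and `S0 = HC_CM` remain OPEN exactly as the route marks them.  Nothing in this
file asserts anything about the status of the Hodge conjecture for CM abelian varieties, which is NOT proved, nor
anything about the original programme.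
-/

set_option autoImplicit false

namespace HodgeRepro.Route

/-! ## The objects of Markman 2025b §1.1 on the route's interface -/

/-- **The data of Markman's construction** (E. Markman, *Secant sheaves on abelian n-folds with real multiplication
and Weil classes on abelian 2n-folds with complex multiplication*, arXiv:2509.23079, store `paper:arxiv-2509.23079`;
abstract p0002:L3–16 and §1.1 p0003:L5–95, p0004:L1–4, re-read by the seat 2026-08-24), as an ABSTRACT INTERFACE over
`RouteData` — nothing is constructed.  As printed: "Let K be a CM-field, i.e., a totally complex quadratic extension of a
totally real field F. Let X be an abelian variety admitting an algebra embedding η̂: F → End_ℚ(X), and let X̂ be the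
dual abelian variety. We construct an embedding η: K → End_ℚ(X × X̂) associated to a choice of a polarization Θ in
∧²_F H¹(X,ℚ) and an element q ∈ F, such that K = F(√−q). We get the [K:ℚ]-dimensional subspace HW(X × X̂, η) of Hodge
Weil classes in H^d(X × X̂, ℚ), where d := 4 dim(X)/[K:ℚ]" (p0002:L3–7); "We associate to (Θ, q) a rational
2^{[F:ℚ]}-dimensional subspace B of S⁺_ℚ such that ℙ(B) is secant to the spinorial variety" (p0002:L9–10); "A B-secant
sheaf is a coherent sheaf G on X with ch(G) in B. Given two B-secant sheaves F₁ and F₂ we get the object E := Φ(F₁ ⊠ F₂^∨)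
in D^b(X × X̂) via Orlov's derived equivalence" (p0004:L1–2); "Assume that r := rank(E) ≠ 0. We prove that the characteristic
class κ(E) := ch(E) exp(−c₁(E)/r) remains of Hodge type under every deformation of (A, η: K → End_ℚ(A)) as an abelian
variety of Weil type" (p0004:L3–4).  Markman's `K` is the route's CM field `F` (Galois over `ℚ`), his totally real `F`
is the route's `F⁺`; a "deformation of (X × X̂, η) as an abelian variety (A′, η′) of Weil type" is, in the route's
vocabulary, a variety `A′` of the interface with `F ⊂ End⁰(A′)` of Weil type. -/
structure SecantData extends RouteData where
  /-- Markman's `X`: "an abelian variety admitting an algebra embedding η̂: F → End_ℚ(X)" of the totally real subfield,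
  together with the choice `(Θ, q)` of his construction (so that `η : K → End_ℚ(X × X̂)` and the secant space `B` are
  determined) -/
  RMVar : Type
  /-- `p := d/2` with `d := 4 dim(X)/[K:ℚ] = dim_K H¹(X × X̂, ℚ)`: the Weil classes `HW(A′, η′) = ∧^d_K H¹(A′, ℚ)` of the
  deformation class of `(X × X̂, η)` live in `H^d(A′, ℚ) = H^{2p}(A′, ℚ)` and are the route's `W_F(A′) ⊂ H^{2p}(A′, ℚ)(p)` -/
  halfDeg : RMVar → ℕ
  /-- a pair `(F₁, F₂)` of `B`-secant sheaves on `X` ("a coherent sheaf G on X with ch(G) in B") -/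
  SecantPair : RMVar → Type
  /-- the genericity criterion of Proposition 1.1.1 for the pair, as printed (p0004:L49–56): "Assume that d > 2, the rank
  of Φ(F₁ ⊠ F₂^∨) is non-zero, and Σ_{(T,T′) : |T∩T′| = {σ}} Π(c_{T,T′}) ≠ 0, for some σ ∈ Σ" ("A generic class in B ⊗ B
  satisfies the criterion, which is an open condition", p0004:L16) -/
  IsGeneric : ∀ {X : RMVar}, SecantPair X → Prop
  /-- `(A′, η′)` is "an abelian variety of Weil type (A′, η′) deformation equivalent to (X × X̂, η)" (Theorem 1.1.2) -/
  WeilDeformEquiv : RMVar → Var → Prop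
  /-- the flat deformation of the class `κ(Φ(F₁ ⊠ F₂^∨)) ∈ H^{ev}(X × X̂, ℚ)` to `(A′, η′)`, by its graded pieces:
  `flatDeform pair A′ k` is the component in `H^{2k}(A′, ℚ)(k) = H k A′` -/
  flatDeform : ∀ {X : RMVar}, SecantPair X → ∀ (A' : Var) (k : ℕ), H k A'

variable (𝓜 : SecantData)

/-! ## Markman 2025b, Theorem 1.1.2 — verbatim -/

/-- **Markman 2025b, Theorem 1.1.2** — arXiv:2509.23079, store `paper:arxiv-2509.23079` p0004:L61–70 (re-read by the seat
2026-08-24): "We summarize the above results as follows. Let F₁ and F₂ be B-secant sheaves satisfying the genericity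
criterion of Proposition (prop-introduction) [= Proposition 1.1.1, p0004:L49–56]. **Theorem 1.1.2.** (Corollary
(corollary-VHC)) A flat deformation of the class κ(Φ(F₁ ⊠ F₂^∨)) remains of Hodge type, on every abelian variety of
Weil type (A′, η′) deformation equivalent to (X × X̂, η). If the flat deformation of the class κ(Φ(F₁ ⊠ F₂^∨)) remains
furthermore algebraic, then every Weil class in HW(A′, η′) is algebraic."  Typed clause by clause: for every `X`, every
generic pair and every `(A′, η′)` of Weil type deformation equivalent to `(X × X̂, η)`, (i) every graded piece of the flat
deformation is a Hodge class, and (ii) if every graded piece is algebraic then `W_F(A′) ⊆` the algebraic classes (in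
degree `p = d/2`).  PRINTED (a 2025 arXiv preprint; the route's §4 item 4 = C2).  A hypothesis here, not a theorem of
the cell. -/
def Markman2025b_Thm1_1_2 : Prop :=
  ∀ (X : 𝓜.RMVar) (pair : 𝓜.SecantPair X), 𝓜.IsGeneric pair →
    ∀ A' : 𝓜.Var, 𝓜.WeilDeformEquiv X A' →
      (∀ k : ℕ, 𝓜.flatDeform pair A' k ∈ 𝓜.hodge k A') ∧
      ((∀ k : ℕ, 𝓜.flatDeform pair A' k ∈ 𝓜.alg k A') →
        𝓜.weil (𝓜.halfDeg X) A' ≤ 𝓜.alg (𝓜.halfDeg X) A')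

/-- Clause (i) of Theorem 1.1.2 alone: "A flat deformation of the class κ(Φ(F₁ ⊠ F₂^∨)) remains of Hodge type, on every
abelian variety of Weil type (A′, η′) deformation equivalent to (X × X̂, η)". -/
theorem Markman2025b_Thm1_1_2.hodgeType (h : Markman2025b_Thm1_1_2 𝓜) {X : 𝓜.RMVar} {pair : 𝓜.SecantPair X}
    (hgen : 𝓜.IsGeneric pair) {A' : 𝓜.Var} (hA' : 𝓜.WeilDeformEquiv X A') (k : ℕ) :
    𝓜.flatDeform pair A' k ∈ 𝓜.hodge k A' :=
  (h X pair hgen A' hA').1 k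

/-- Clause (ii) of Theorem 1.1.2 alone: "If the flat deformation of the class κ(Φ(F₁ ⊠ F₂^∨)) remains furthermore
algebraic, then every Weil class in HW(A′, η′) is algebraic". -/
theorem Markman2025b_Thm1_1_2.weil_le_alg (h : Markman2025b_Thm1_1_2 𝓜) {X : 𝓜.RMVar} {pair : 𝓜.SecantPair X}
    (hgen : 𝓜.IsGeneric pair) {A' : 𝓜.Var} (hA' : 𝓜.WeilDeformEquiv X A')
    (halg : ∀ k : ℕ, 𝓜.flatDeform pair A' k ∈ 𝓜.alg k A') :
    𝓜.weil (𝓜.halfDeg X) A' ≤ 𝓜.alg (𝓜.halfDeg X) A' :=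
  (h X pair hgen A' hA').2 halg

/-! ## The OPEN input of §4 item 4, and the closer composed with the chain -/

/-- **OPEN input (C2)** — ROUTE.md §4 item 4 as stated: for every instance `B` of `S4` (split Weil type relative to `F`,
`2p` corners) there is an abelian variety `X` with real multiplication by `F⁺` and a `B`-secant pair `(F₁, F₂)` on `X`
satisfying the genericity criterion, with `B` of Weil type deformation equivalent to `(X × X̂, η)` in the right degree
(`d = 2p`), whose flat deformation of `κ(Φ(F₁ ⊠ F₂^∨))` to `B` is algebraic — exactly the hypothesis of clause (ii) of
Theorem 1.1.2 at `B`.  OPEN: Markman p0005:L1–3, "We postpone for future work the search for semiregular B-secant sheaves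
for CM-fields with [K:ℚ] > 2"; abstract p0002:L14–16, "Examples of such F₁ and F₂ are provided for X the Jacobian with
real multiplication by F of a genus 4 curve when [F:ℚ] = 2 and Gal(K/ℚ) ≅ ℤ/2ℤ × ℤ/2ℤ, but the semi-regularity of E has
not been addressed yet". -/
def OpenSecantPair : Prop :=
  ∀ (p : ℕ), 1 ≤ p → ∀ B : 𝓜.Var, 𝓜.SplitWeil p B →
    ∃ (X : 𝓜.RMVar) (pair : 𝓜.SecantPair X), 𝓜.IsGeneric pair ∧ 𝓜.halfDeg X = p ∧
      𝓜.WeilDeformEquiv X B ∧ ∀ k : ℕ, 𝓜.flatDeform pair B k ∈ 𝓜.alg k B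

/-- The «whole deformation class» form of the same input (ROUTE.md §4 item 4: "Closes S4 for the whole deformation class
of B … once ONE such pair exists with ch(F₁) ⊗ ch(F₂) generic"): one generic pair per class whose flat deformation is
algebraic on EVERY Weil-type deformation of `(X × X̂, η)`. -/
def OpenSecantPairClass : Prop :=
  ∀ (p : ℕ), 1 ≤ p → ∀ B : 𝓜.Var, 𝓜.SplitWeil p B →
    ∃ (X : 𝓜.RMVar) (pair : 𝓜.SecantPair X), 𝓜.IsGeneric pair ∧ 𝓜.halfDeg X = p ∧
      𝓜.WeilDeformEquiv X B ∧
      ∀ A' : 𝓜.Var, 𝓜.WeilDeformEquiv X A' → ∀ k : ℕ, 𝓜.flatDeform pair A' k ∈ 𝓜.alg k A'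

/-- The class form gives the pointwise form (take `A′ = B`). -/
theorem OpenSecantPair_of_class (h : OpenSecantPairClass 𝓜) : OpenSecantPair 𝓜 := by
  intro p hp B hB
  obtain ⟨X, pair, hgen, hdeg, hB', halg⟩ := h p hp B hB
  exact ⟨X, pair, hgen, hdeg, hB', halg B hB'⟩

/-- **C2 closes S4**: Theorem 1.1.2 (printed) and the open input give `S4` — clause (ii) at `B`, in degree `p = d/2`. -/
theorem S4_of_secantPair (hM : Markman2025b_Thm1_1_2 𝓜) (h : OpenSecantPair 𝓜) : S4 𝓜.toRouteData := by
  intro p hp B hB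
  obtain ⟨X, pair, hgen, hdeg, hB', halg⟩ := h p hp B hB
  have hle := hM.weil_le_alg 𝓜 hgen hB' halg
  rwa [hdeg] at hle

/-- **C2 closes S0** through the chain of `RouteChain` (`S0 ⇐ S1 ∧ S2 ∧ S3 ∧ S4`). -/
theorem S0_of_openSecantPair (hpull : AlgPull 𝓜.toRouteData)
    (h123 : S1 𝓜.toRouteData ∧ S2 𝓜.toRouteData ∧ S3 𝓜.toRouteData)
    (hM : Markman2025b_Thm1_1_2 𝓜) (h : OpenSecantPair 𝓜) : S0 𝓜.toRouteData :=
  S0_of_S1_S2_S3_S4 𝓜.toRouteData hpull ⟨h123.1, h123.2.1, h123.2.2, S4_of_secantPair 𝓜 hM h⟩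

/-! ## The semiregularity form of the input -/

/-- `SecantData` with the predicate "the pair `(F₁, F₂)` is equivariantly semi-regular in the sense of Buchweitz–Flenner"
(Markman p0005:L1–3: "the B-secant sheaves F₁ and F₂ on X were chosen to be equivariantly semi-regular in the sense of
Buchweitz-Flenner [buchweitz-flenner]"). -/
structure SemiregularData extends SecantData where
  /-- `(F₁, F₂)` is equivariantly semi-regular in the sense of Buchweitz–Flenner -/
  IsSemiregular : ∀ {X : RMVar}, SecantPair X → Prop

variable (𝓢 : SemiregularData)

/-- **The route's clause «semiregularity (Buchweitz–Flenner) makes the deformation algebraic»** (ROUTE.md §4 item 4),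
NAMED as a hypothesis: a semiregular pair's flat deformation of `κ(Φ(F₁ ⊠ F₂^∨))` is algebraic on every Weil-type
deformation of `(X × X̂, η)`.  NOT printed in this generality — Markman p0005:L1–3 prints it for `F⁺ = ℚ` and `X` the
Jacobian of a genus-3 curve: "In [markman-sixfolds] the flat deformations of the class κ(Φ(F₁ ⊠ F₂^∨)) were shown to
remain algebraic, when F = ℚ, X is the Jacobian of a genus 3 curve, and the B-secant sheaves F₁ and F₂ on X were chosen
to be equivariantly semi-regular in the sense of Buchweitz-Flenner"; the abstract p0002:L13 says "The algebraicity would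
thus follow if E is semiregular in the appropriate sense".  Nothing asserted. -/
def SemiregularDeforms : Prop :=
  ∀ (X : 𝓢.RMVar) (pair : 𝓢.SecantPair X), 𝓢.IsSemiregular pair →
    ∀ A' : 𝓢.Var, 𝓢.WeilDeformEquiv X A' → ∀ k : ℕ, 𝓢.flatDeform pair A' k ∈ 𝓢.alg k A'

/-- **OPEN input (C2), semiregularity form** — the "search for semiregular B-secant sheaves for CM-fields with
[K:ℚ] > 2" Markman postpones (p0005:L2–3): for every `S4` instance `B`, a generic SEMIREGULAR pair on some `X` with `B`
of Weil type deformation equivalent to `(X × X̂, η)` in degree `d = 2p`. -/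
def OpenSemiregularPair : Prop :=
  ∀ (p : ℕ), 1 ≤ p → ∀ B : 𝓢.Var, 𝓢.SplitWeil p B →
    ∃ (X : 𝓢.RMVar) (pair : 𝓢.SecantPair X), 𝓢.IsGeneric pair ∧ 𝓢.halfDeg X = p ∧
      𝓢.WeilDeformEquiv X B ∧ 𝓢.IsSemiregular pair

/-- A semiregular pair per instance, with the route's clause, gives the class form of the input. -/
theorem OpenSecantPairClass_of_semiregular (hS : SemiregularDeforms 𝓢) (h : OpenSemiregularPair 𝓢) :
    OpenSecantPairClass 𝓢.toSecantData := by
  intro p hp B hB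
  obtain ⟨X, pair, hgen, hdeg, hB', hsemi⟩ := h p hp B hB
  exact ⟨X, pair, hgen, hdeg, hB', fun A' hA' k => hS X pair hsemi A' hA' k⟩

/-- **C2 in its semiregularity form closes S4**: Theorem 1.1.2 (printed), the route's clause, and a semiregular generic
pair per instance. -/
theorem S4_of_semiregularPair (hM : Markman2025b_Thm1_1_2 𝓢.toSecantData) (hS : SemiregularDeforms 𝓢)
    (h : OpenSemiregularPair 𝓢) : S4 𝓢.toRouteData :=
  S4_of_secantPair 𝓢.toSecantData hM
    (OpenSecantPair_of_class 𝓢.toSecantData (OpenSecantPairClass_of_semiregular 𝓢 hS h))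

/-! ## Six named open inputs in one statement -/

/-- **The merged interface**: `ClosersData` (the four chains of `Night4Closers`) together with the objects of Markman's
construction; overlapping fields are merged by name.  The fields assert nothing. -/
structure SecantClosersData extends ClosersData, SecantData

variable (𝓒 : SecantClosersData)

/-- **The PRINTED inputs of the six chains, bundled**: those of `Night4Closers.PrintedInputs` and Markman 2025b
Theorem 1.1.2. -/
structure PrintedInputs₆ : Prop extends PrintedInputs 𝓒.toClosersData where
  /-- Markman 2025b Thm 1.1.2 (secant sheaves and Weil classes) -/
  markman2025b : Markman2025b_Thm1_1_2 𝓒.toSecantData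

/-- **OPEN input 6 — C2**: the secant-pair input of ROUTE.md §4 item 4 (`OpenSecantPair`). -/
def OpenSecant : Prop :=
  OpenSecantPair 𝓒.toSecantData

/-- **Chain 6** — the secant-pair input closes `S0` (Theorem 1.1.2 + the chain of `RouteChain`). -/
theorem S0_of_openSecant (hP : PrintedInputs₆ 𝓒) (h : OpenSecant 𝓒) : S0 𝓒.toRouteData :=
  S0_of_openSecantPair 𝓒.toSecantData hP.pull ⟨hP.s1, hP.s2, hP.s3⟩ hP.markman2025b h

/-- **SIX NAMED OPEN INPUTS IN ONE STATEMENT** — the five of `Night4Closers.S0_of_any_closer₅` (the faces of degree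
`≥ 8`, the invariant cycles conjecture, VHC, the Lefschetz standard conjecture for the total spaces, Route C's
conditional content) and C2 (a generic secant pair per instance whose flat deformation is algebraic): `S0` follows from
the printed inputs, the cell's lemmas, and ANY ONE of them. -/
theorem S0_of_any_closer₆ (hP : PrintedInputs₆ 𝓒) (hL : CellLemmas 𝓒.toClosersData)
    (h : OpenFrontier 𝓒.toClosersData ∨ OpenInvariantCycles 𝓒.toClosersData ∨ OpenVHC 𝓒.toClosersData ∨
      OpenLefschetz 𝓒.toClosersData ∨ OpenRouteC 𝓒.toClosersData ∨ OpenSecant 𝓒) :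
    S0 𝓒.toRouteData := by
  rcases h with h | h | h | h | h | h
  · exact S0_of_openFrontier 𝓒.toClosersData hP.toPrintedInputs hL h
  · exact S0_of_openInvariantCycles 𝓒.toClosersData hP.toPrintedInputs hL h
  · exact S0_of_openVHC 𝓒.toClosersData hP.toPrintedInputs h
  · exact S0_of_openLefschetz 𝓒.toClosersData hP.toPrintedInputs h
  · exact S0_of_openRouteC 𝓒.toClosersData hP.toPrintedInputs h
  · exact S0_of_openSecant 𝓒 hP h

end HodgeRepro.Route
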